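import Summits.QuantumAdvantage.QuantumAdvantage.Theorems.CharDialWindowCounter
import Summits.QuantumAdvantage.AdviceFreeQNC0.AffBells22WalkHardAllSubcube
import HarnessLib

/-!
# CharDial / SliceDial — the ENGINE of piece R1: «`log₂ n`-JUNTAS ⊕ ONE linear form mod p» twisted win sums are `o(2ⁿ)`
# in dense directions (`formJunta_small`, §I), and «polylog WINDOW ⊕ ONE linear form» strategies lose (`formWindow_hard`)

decomp-qadv lens-6 («barrier-complement carving») g11 — tree part 16Δ (rev 11): the DELTA of part 16 over the
LANDED `Theorems.CharDialWindowCounter` (§A–§E = R1w `windowCounter_hard`, R1a `ownBitCounter_hard`, the register transfer,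
the counter-dial Fourier reduction — landed by census-1 as `CharDialWindowCounterA/B/·`).  This file = §F–§I (position-
dependent twists, the form dial, sparse directions, the class-conditioned block product `formJunta_small`) + the two helper
lemmas `card_fun_bool` (here replaced by Mathlib's `Fintype.card_fun`/`card_bool`/`card_fin`), `norm_char` the landing inlined.  It checks DIRECTLY against the tree.  Supports
`stmt-QuantumAdvantage-27049` = `CharDial.RankOneHardJLinOdd` (proved BY NAME by part 17 `CharDialRankOne.lean` = this file +
the landed `CharDialJLinSlice` + 60 lines of JLin glue), equally `stmt-QuantumAdvantage-32604` = `CharDial.WalkHardFJLinOdd`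
(part 18 `CharDialSpreadRank.lean`: W_r, polylog juntas, one sparse line).  Prop-free, sorry-free.

## Main theorems

`formJunta_small` (§I, the estimate behind R1 — NEW in rev 7).  For every prime `p ≥ 5` and every `ε > 0`, for all large
`n`: for every charge `c`, every direction `a : Fin n → ZMod p` with `2·#{i : a_i ≠ 0} ≥ n`, every strategy `y` all of whose
cuts are `log₂ n`-JUNTAS (reading ≤ `log₂ n` bits ANYWHERE), and every `t ≠ 0`,
`‖Σ_u [WIN_y u] ψ_p(t⟨a,u⟩)‖ ≤ ε · 2ⁿ` (`formSum`).  With the form-dial Fourier reduction `form_reduction` (§G) and the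
tree's junta rung this gives the rank-one piece R1 of 32604 in dense directions; sparse directions are part 12's slicing.

`windowCounter_hard` (§D, R1w).  For every prime `p ≥ 5` there is ONE `θ < 1` such that for every `C`, for all large `n`,
every charge `c` and every class-indexed family `Y : ZMod p → strategy` whose members are WINDOW-LOCAL at width `(log₂ n)^C`
(cut `g` of `Y s` reads only the bits `[g - ℓ, g + ℓ - 1]`, `ℓ = (log₂ n)^C`, the tree's `WindowLocal`), the COUNTER-DIAL
strategy `u ↦ Y_{wt u mod p}(·, u)` (`counterStrat`) wins α's u-walk game (`ringWinU`) on at most `θ · 2ⁿ` inputs.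

`formWindow_hard` (§H, R1ʷ).  The same with the counter replaced by ANY linear form: ONE `θ < 1` (depending on `p` only)
such that for every `C`, eventually, for EVERY direction `a : Fin n → ZMod p`, the FORM-DIAL strategy
`u ↦ Y_{⟨a,u⟩ mod p}(·, u)` (`formStrat`) over window-`(log₂ n)^C` tables wins on at most `θ · 2ⁿ` inputs.  In the
presentation class of 32604 (junta ⊕ linear form over `𝔽_p`) this is the RANK-ONE piece (all cuts' forms proportional to one
direction, blind cuts allowed — re-present `h_g(u, s) ↦ h_g(u, l_g s)`) for INTERVAL juntas of any polylog width; it lies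
outside every previously proved rung (`WindowLocalHardU`: the form is global; `FinState`/R11/`LinTestsOdd`: window bits are
not functions of prefix counts; `walkHardAllSubcube`/sparse-direction rungs: `a` may be dense).  What it does NOT cover:
`log₂ n`-juntas at ARBITRARY positions (the NODE's typed open rung R1b / `TwistedJuntaBias`).

## (Landed, `CharDialWindowCounter`) proof of `windowCounter_hard` (§A–§D) — recalled for the notation of §F–§I

COUNTER-DIAL FOURIER REDUCTION (`counter_reduction`, generic in the class `good`): with the standard additive character `ψ`
of `ZMod p`, `p · #{wt ≡ s, WIN_y} = #WIN_y + Σ_{t ≠ 0} ψ(-ts) A_t(y)`, `A_t(y) = Σ_u [WIN_y u] ψ(t)^{wt u}`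
(`class_count_le_twist`); so a class that loses with rate `θ₀` (`h1`, here the tree's `windowLocalHardU`) and has
`A_t = o(2ⁿ)` uniformly (`h2`) yields counter-dial strategies losing with rate `(1 + θ₀)/2`.
`h2` FOR WINDOW STRATEGIES (`window_twist_small`): `[WIN] = (1 - ∏_g sgn_g)/2` (`win_indicator`); on the class
`wt ≡ w (mod 3)` the sign of cut `g` is EMITTED AT TIME `k = g + ℓ - 1` by a sign table `Etab` reading the REGISTER of the
last `2ℓ` bits and the prefix count `mod 3` (the exponent `c + g + wt u + wtPrefix u g` is recovered as
`c + g + w + P_k + 2·ones(register.take (ℓ-1)) (mod 3)`), the last `ℓ` cuts by a final factor `ftab`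
(`sign_split_window`, §C); removing the `mod 3` condition with the characters of `ZMod 3` (`three_mul_classSum`) leaves
REGISTER TRANSFER sums `GG(μ) = Σ_v μ^{wt v} ∏_j sgn(E_j(register_j, v_j, P_j)) Φ(register_n, P_n)`, `μ = ψ_p(t)ψ₃(r)`,
`μ⁶ ≠ 1`.  §B bounds them for ANY `W`-local 3-periodic sign table: over a block of `W + 3` bits the continuations
`000·s` and `111·s` (`s ∈ {0,1}^W`) end on registers with the same top `W` cells and on prefix counts differing by `3`,
with twist ratio `μ³` and REAL signs, so `‖GG_{W+3}‖ ≤ 2^W (6 + β) ‖Φ‖` with `β = max ‖1 ± μ³‖ < 2`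
(`norm_GG_block_le`, `beta_lt_two`), whence `‖GG_n‖ ≤ 2ⁿ κ^{⌊n/(W+3)⌋}`, `κ = (6+β)/8 < 1` (`norm_GG_le_kappa`) and
`‖A_t‖ ≤ 2 · 2ⁿ κ^{⌊n/(2ℓ+3)⌋} = o(2ⁿ)` as long as `ℓ = o(n)` — for `ℓ = (log₂ n)^C` by the tree's
`DWalk.const_mul_logPow_le'`.  §E: `ownBitCounter_hard` (R1a) is the case `C = 0`.

## Proof of `formWindow_hard` (§F–§H)

DENSE directions (`2·#{i : a_i ≠ 0} ≥ n`, §F–§G): the same reduction in the form value (`form_reduction`,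
`class_count_le_form`: `p · #{⟨a,u⟩ = s, WIN_y} ≤ #WIN_y + Σ_{t ≠ 0} ‖A_t^a(y)‖`, `A_t^a(y) = Σ_u [WIN_y u] ψ(t⟨a,u⟩)`), and
the register transfer with POSITION-DEPENDENT twists `μ_i = ψ_p(t a_i)ψ₃(r)` (`PG`, §F): a block of `W + 3` bits opened at
`k` contracts by the factor `(6 + β)/8` as soon as SOME pair `X ≠ X'` of 3-bit openings with `wt X' − wt X ∈ {0, 3}` has
`‖tw_k(X)σ + tw_k(X')σ'‖ ≤ β` for all signs `σ, σ'` (`norm_PG_block_le`; the `W` following bits flush the register and the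
two prefix counts agree `mod 3`).  For the form twist such a pair exists at EVERY `k` with `a_k ≠ 0` (`pair_XF`): `100/010`
if `a_k ≠ a_{k+1}` (ratio `ψ(t(a_{k+1} − a_k))`), `010/001` if `a_k = a_{k+1} ≠ a_{k+2}`, `000/111` if
`a_k = a_{k+1} = a_{k+2}` (ratio `ψ(3 t a_k) ≠ ±1` as `p ∤ 6`), with `β_F = max_{z ≠ 0} ‖1 ± ψ(z)‖ < 2` (`betaF_lt_two`).
Blocks are placed GREEDILY (`nb`: open at a good position, else skip one bit): `‖PG_L‖ ≤ 2^L κ_F^{nb}` (`norm_PG_sched`) and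
`#good ≤ (W+3)·nb + W + 2` (`cnt_le_nb`), so `nb ≥ q₀` once `(2ℓ+3)(q₀+1) ≤ n/2 ≤ #supp a` (`form_twist_small_dense`).
SPARSE directions (`2·#supp a ≤ n`, §H): fix the bits on `W = supp a`; on each subcube the form is constant (`linF_merge`),
so the form dial restricted to it is a window strategy whose cuts are juntas of `≤ 2ℓ ≤ (log₂ n)^{C+1}` free bits
(`junta_hasDeg`), the tree's `walkHardAllSubcube` (density `1/2`) bounds every subcube with ONE `θ₁`, and fibre counting
(`sum_card_merge`) sums them (`form_sparse_hard`).  `formWindow_hard`: `θ = max(θ₁, (1+θ_U)/2)`.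

## Proof of `formJunta_small` (§I) — the CLASS-CONDITIONED BLOCK PRODUCT (no transfer operator)

Write `[WIN] = (1 − F)/2`, `F(u) = ∏_g sgn(fires_g u)` (`win_indicator`), `Q(u) = F(u) ψ_p(t⟨a,u⟩)` (`Qf`).  A block is
`{k, k+1, k+2}` with `k + 3 ≤ n`; it is GOOD if `a_k ≠ 0`; cut `g` TOUCHES it if `g` reads a junta bit in it or sits strictly
inside it (`touch`); a family of blocks is admissible if pairwise SEPARATED and NON-INTERACTING (no cut touches two).
(1) EXCHANGE (`fires_setBlk_congr`, `Qf_exchange`): for a cut not touching block `k`, `fires_g` depends on the block's bits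
only through `wt(X) mod 3` (before the block: not at all; after it: through the prefix count).  Hence for two admissible
blocks and openings `X, X'`, `Y, Y'` with `wt X ≡ wt X'`, `wt Y ≡ wt Y' (mod 3)` the four-point identity
`Q(X'Y)Q(XY') = Q(XY)Q(X'Y')` holds factor by factor (cuts touching neither / only `k₀` / only `k₁`; the character by
linearity, `linF_setBlk`).  (2) CLASS-CONDITIONED MULTI-SUMS (`msum`): fix the classes `c_j = wt(X_j) mod 3` of ALL blocks
and sum `Q` over openings in those classes; by (1) and induction the multi-sum has the RATIO PROPERTY
`M(X' v)·Q(fill X v) = M(X v)·Q(fill X' v)` (`msum_ratio`, `fill` = representative openings), so peeling the first block,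
the class sum `Σ_{X ∈ Cl c} M(X v)` is `M(X₀ v)/Q(fill X₀ v) · Σ_X Q(fill X v)` and the CONTRACTING PAIR `XF/XF'` of §G
(`100/010`, `010/001` or `000/111` according to `a_k, a_{k+1}, a_{k+2}`; same class, form values differing by `z ≠ 0`,
`blkF_pair`) gives `‖Q(fill XF v) + Q(fill XF' v)‖ ≤ β_F` (`norm_Qf_pair_le`): the class containing the pair contributes
`#Cl − 2 + β_F`, the others `#Cl` (`bcl`, `msum_bound`: `‖M‖ ≤ ∏_j bcl_j(c_j)`).  (3) AVERAGING (`sum_msum_avg`,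
`sum_setBlk`): `Σ_{class vectors} Σ_u M(u) = 8^m Σ_u Q(u)`, and `Σ_{c} bcl(c) = 6 + β_F` (`sum_bcl`), so
`‖Σ_u Q(u)‖ ≤ 2ⁿ ((6+β_F)/8)^m = 2ⁿ κ_F^m` (`norm_sum_Qf_le`).  (4) SELECTION (`exists_blocks`): take the good starts
`k ≡ r (mod 3)` in the best residue class (`≥ (#supp a − 2)/3`, pairwise separated); a cut touches at most `ℓ + 1` of them
(`card_touch_le`, `ℓ = log₂ n`), so in the interaction graph `Σ_k deg k ≤ Σ_g τ_g² ≤ (n+1)(ℓ+1)²` (`sum_deg_le`); by Markov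
half of the starts have degree `≤ 2(n+1)(ℓ+1)²/#T` and the greedy independent set (`exists_indep`) has
`m ≥ #T²/(2(2(n+1)(ℓ+1)² + #T)) ≥ n/(4896 ℓ²)` members in a dense direction — unbounded, by `DWalk.const_mul_logPow_le'`.
The same bound for the all-false strategy controls `Σ_u ψ_p(t⟨a,u⟩)`, and `formSum = (Σψ − ΣQ)/2`.
-/

noncomputable section
open Finset

namespace Summit.QuantumAdvantage.AdviceFreeQNC0.WindowCounter

open Summit.QuantumAdvantage.AdviceFreeQNC0

/-- (helper of part 14, inlined by the landing; re-added for §F–§I) `‖ψ(x)‖ = 1`. -/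
theorem norm_char (N : ℕ) [NeZero N] (x : ZMod N) : ‖(ZMod.stdAddChar x : ℂ)‖ = 1 := AddChar.norm_apply _ _

/-! ## §F POSITION-DEPENDENT TWISTS — the register transfer for an arbitrary linear form `⟨a,u⟩ mod p`

The twist of bit `i` is now `μ i` (for the form dial `μ i = ψ_p(t a_i) ψ₃(r)`); a block `[k, k+W+3)` contracts as soon as
SOME pair `X ≠ X'` of 3-bit openings with `wt X' − wt X ∈ {0, 3}` has `‖tw X σ + tw X' σ'‖ ≤ β < 2` for all signs — for the
form dial this holds at every `k` with `a_k ≠ 0` (§G).  Blocks are placed GREEDILY (`nb`); `‖PG_L‖ ≤ 2^L κ^{nb}`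
(`norm_PG_sched`) and the greedy count is `≥ (#{good positions} − W − 2)/(W+3)` (`cnt_le_nb`). -/

section PTransfer

variable (μ : ℕ → ℂ) (E : ℕ → List Bool → Bool → ℕ → Bool)

/-- the position-dependent twist collected along `v` read from time `k`. -/
def tw {m : ℕ} (k : ℕ) (v : Fin m → Bool) : ℂ := ∏ j : Fin m, if v j then μ (k + j.val) else 1

/-- CharDialFormJuntaA helper `tw_cons` (decomp-qadv land package; see the module docstring). -/
theorem tw_cons {m : ℕ} (k : ℕ) (b : Bool) (v : Fin m → Bool) :
    tw μ k (Fin.cons b v : Fin (m + 1) → Bool) = (if b then μ k else 1) * tw μ (k + 1) v := by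
  unfold tw
  rw [Fin.prod_univ_succ]
  simp only [Fin.cons_zero, Fin.cons_succ, Fin.val_zero, add_zero, Fin.val_succ]
  congr 1
  refine prod_congr rfl fun j _ => ?_
  rw [show k + (j.val + 1) = k + 1 + j.val by ring]

/-- CharDialFormJuntaA helper `norm_tw` (decomp-qadv land package; see the module docstring). -/
theorem norm_tw (hμ : ∀ i, ‖μ i‖ = 1) {m : ℕ} (k : ℕ) (v : Fin m → Bool) : ‖tw μ k v‖ = 1 := by
  unfold tw
  rw [norm_prod]
  exact prod_eq_one fun j _ => by split_ifs <;> simp [hμ]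

/-- the position-twisted signed path sum with continuation `Φ`. -/
def PG (Φ : ℕ → List Bool → ℕ → ℂ) (L k : ℕ) (r : List Bool) (P : ℕ) : ℂ :=
  ∑ v : Fin L → Bool, tw μ k v * pathSgn E k r P v * Φ (k + L) (regAt v L r) (P + wt v)

variable (Φ : ℕ → List Bool → ℕ → ℂ)

/-- CharDialFormJuntaA helper `PG_zero` (decomp-qadv land package; see the module docstring). -/
theorem PG_zero (k : ℕ) (r : List Bool) (P : ℕ) : PG μ E Φ 0 k r P = Φ k r P := by
  simp [PG, pathSgn, regAt, wt, tw]

/-- recursion: peel the first bit. -/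
theorem PG_succ (L k : ℕ) (r : List Bool) (P : ℕ) :
    PG μ E Φ (L + 1) k r P =
      sgn (E k r false P) * PG μ E Φ L (k + 1) (false :: r) P +
        μ k * sgn (E k r true P) * PG μ E Φ L (k + 1) (true :: r) (P + 1) := by
  unfold PG
  rw [← (Fin.consEquiv fun _ : Fin (L + 1) => Bool).sum_comp, Fintype.sum_prod_type, Fintype.sum_bool]
  simp only [Fin.consEquiv, Equiv.coe_fn_mk, wt_cons, pathSgn_cons, regAt_cons_succ, Bool.toNat_true,
    Bool.toNat_false, add_zero, mul_sum, tw_cons, Bool.false_eq_true, ↓reduceIte, one_mul]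
  have e1 : k + (L + 1) = k + 1 + L := by ring
  have e2 : ∀ x : ℕ, P + (1 + x) = P + 1 + x := fun x => by ring
  simp only [e1, e2]
  rw [add_comm]
  congr 1 <;> refine sum_congr rfl fun w _ => ?_ <;> ring

/-- composition. -/
theorem PG_comp (m L k : ℕ) (r : List Bool) (P : ℕ) :
    PG μ E Φ (m + L) k r P = PG μ E (fun k' r' P' => PG μ E Φ m k' r' P') L k r P := by
  induction L generalizing k r P with
  | zero => rw [PG_zero]; rfl
  | succ L ih => rw [show m + (L + 1) = m + L + 1 from rfl, PG_succ, PG_succ, ih, ih]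

/-- CharDialFormJuntaA helper `PG_periodic` (decomp-qadv land package; see the module docstring). -/
theorem PG_periodic (hE : ∀ k r b P, E k r b (P + 3) = E k r b P) (hΦ : ∀ k r P, Φ k r (P + 3) = Φ k r P)
    (L k : ℕ) (r : List Bool) (P : ℕ) : PG μ E Φ L k r (P + 3) = PG μ E Φ L k r P := by
  unfold PG
  refine sum_congr rfl fun v _ => ?_
  rw [pathSgn_periodic E hE, add_right_comm, hΦ]

/-- CharDialFormJuntaA helper `PG_local` (decomp-qadv land package; see the module docstring). -/
theorem PG_local {W : ℕ} (hE : ∀ k ρ ρ' b P, ρ.take W = ρ'.take W → E k ρ b P = E k ρ' b P)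
    (hΦ : ∀ k ρ ρ' P, ρ.take W = ρ'.take W → Φ k ρ P = Φ k ρ' P) (L k : ℕ) {r r' : List Bool}
    (h : r.take W = r'.take W) (P : ℕ) : PG μ E Φ L k r P = PG μ E Φ L k r' P := by
  unfold PG
  refine sum_congr rfl fun v _ => ?_
  rw [pathSgn_local E hE k h, hΦ (k + L) (regAt v L r) (regAt v L r') (P + wt v)
    (by unfold regAt; exact take_append_congr _ h)]

/-- the trivial bound, with the continuation bounded at the END time only. -/
theorem norm_PG_le_basic (hμ : ∀ i, ‖μ i‖ = 1) {M : ℝ} {L k : ℕ} (hΦ : ∀ r P, ‖Φ (k + L) r P‖ ≤ M)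
    (r : List Bool) (P : ℕ) : ‖PG μ E Φ L k r P‖ ≤ 2 ^ L * M := by
  unfold PG
  refine le_trans (norm_sum_le _ _) ?_
  calc ∑ v : Fin L → Bool, ‖tw μ k v * pathSgn E k r P v * Φ (k + L) (regAt v L r) (P + wt v)‖
      ≤ ∑ _v : Fin L → Bool, M := sum_le_sum fun v _ => by
        rw [norm_mul, norm_mul, norm_tw μ hμ, norm_pathSgn, one_mul, one_mul]; exact hΦ _ _
    _ = 2 ^ L * M := by rw [sum_const, card_univ, Fintype.card_fun, Fintype.card_bool, Fintype.card_fin, nsmul_eq_mul]; push_cast; ring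

/-- **THE BLOCK CONTRACTION with a general contracting pair of openings** `X ≠ X'`, `wt X' − wt X ∈ {0,3}`. -/
theorem norm_PG_block_le (hμ : ∀ i, ‖μ i‖ = 1) {β : ℝ} {W k : ℕ} (X X' : Fin 3 → Bool) (hX : X' ≠ X)
    (hw : wt X' = wt X ∨ wt X' = wt X + 3)
    (hpair : ∀ a b : Bool, ‖tw μ k X * sgn a + tw μ k X' * sgn b‖ ≤ β)
    (hΦl : ∀ k ρ ρ' P, ρ.take W = ρ'.take W → Φ k ρ P = Φ k ρ' P) (hΦp : ∀ k r P, Φ k r (P + 3) = Φ k r P)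
    {M : ℝ} (_hM : 0 ≤ M) (hΦ : ∀ r P, ‖Φ (k + 3 + W) r P‖ ≤ M) (r : List Bool) (P : ℕ) :
    ‖PG μ E Φ (W + 3) k r P‖ ≤ 2 ^ W * (6 + β) * M := by
  rw [PG_comp]
  set Ψ : ℕ → List Bool → ℕ → ℂ := fun k' r' P' => PG μ E Φ W k' r' P' with hΨ
  have hΨM : ∀ r P, ‖Ψ (k + 3) r P‖ ≤ 2 ^ W * M := fun r P => norm_PG_le_basic μ E Φ hμ hΦ r P
  have hx : X' ∈ univ.erase X := by rw [mem_erase]; exact ⟨hX, mem_univ _⟩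
  set T : (Fin 3 → Bool) → ℂ := fun x => tw μ k x * pathSgn E k r P x * Ψ (k + 3) (regAt x 3 r) (P + wt x) with hT
  have hGG : PG μ E Ψ 3 k r P = T X + T X' + ∑ x ∈ (univ.erase X).erase X', T x := by
    unfold PG; rw [← add_sum_erase _ _ (mem_univ X), ← add_sum_erase _ _ hx, add_assoc]
  have hcard : ((univ.erase X).erase X').card = 6 := by
    rw [card_erase_of_mem hx, card_erase_of_mem (mem_univ _), card_univ, Fintype.card_fun, Fintype.card_bool, Fintype.card_fin]; rfl
  have hplain : ∀ x, ‖T x‖ ≤ 2 ^ W * M := fun x => by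
    rw [hT]; dsimp only
    rw [norm_mul, norm_mul, norm_tw μ hμ, norm_pathSgn, one_mul, one_mul]; exact hΨM _ _
  have hrest : ‖∑ x ∈ (univ.erase X).erase X', T x‖ ≤ 6 * (2 ^ W * M) := by
    refine le_trans (norm_sum_le _ _) ?_
    calc _ ≤ ∑ _x ∈ (univ.erase X).erase X', 2 ^ W * M := sum_le_sum fun x _ => hplain x
      _ = 6 * (2 ^ W * M) := by rw [sum_const, hcard, nsmul_eq_mul]; push_cast; ring
  obtain ⟨a₀, ha₀⟩ := exists_pathSgn_eq E k r P X
  obtain ⟨a₁, ha₁⟩ := exists_pathSgn_eq E k r P X'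
  have hβ0 : 0 ≤ β := le_trans (norm_nonneg _) (hpair false false)
  -- the count seen by `Φ` after the two openings agree mod 3
  have eP : ∀ s : Fin W → Bool, Φ (k + 3 + W) (regAt s W (regAt X' 3 r)) (P + wt X' + wt s) =
      Φ (k + 3 + W) (regAt s W (regAt X 3 r)) (P + wt X + wt s) := by
    intro s
    rw [hΦl _ _ (regAt s W (regAt X 3 r)) _ (take_regAt_full le_rfl s _ _)]
    rcases hw with h | h
    · rw [h]
    · rw [h, show P + (wt X + 3) + wt s = P + wt X + wt s + 3 by ring, hΦp]
  have hpair' : ‖T X + T X'‖ ≤ β * (2 ^ W * M) := by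
    rw [hT]; dsimp only
    rw [ha₀, ha₁, hΨ]
    dsimp only
    unfold PG
    rw [mul_sum, mul_sum, ← sum_add_distrib]
    refine le_trans (norm_sum_le _ _) ?_
    calc ∑ s : Fin W → Bool, ‖tw μ k X * sgn a₀ * (tw μ (k + 3) s * pathSgn E (k + 3) (regAt X 3 r) (P + wt X) s *
              Φ (k + 3 + W) (regAt s W (regAt X 3 r)) (P + wt X + wt s)) +
            tw μ k X' * sgn a₁ * (tw μ (k + 3) s * pathSgn E (k + 3) (regAt X' 3 r) (P + wt X') s *
              Φ (k + 3 + W) (regAt s W (regAt X' 3 r)) (P + wt X' + wt s))‖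
        ≤ ∑ _s : Fin W → Bool, β * M := sum_le_sum fun s _ => by
          obtain ⟨b₀, hb₀⟩ := exists_pathSgn_eq E (k + 3) (regAt X 3 r) (P + wt X) s
          obtain ⟨b₁, hb₁⟩ := exists_pathSgn_eq E (k + 3) (regAt X' 3 r) (P + wt X') s
          rw [hb₀, hb₁, eP s]
          have : tw μ k X * sgn a₀ * (tw μ (k + 3) s * sgn b₀ * Φ (k + 3 + W) (regAt s W (regAt X 3 r)) (P + wt X + wt s)) +
              tw μ k X' * sgn a₁ * (tw μ (k + 3) s * sgn b₁ *
                Φ (k + 3 + W) (regAt s W (regAt X 3 r)) (P + wt X + wt s)) =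
              tw μ (k + 3) s * (tw μ k X * sgn (xor a₀ b₀) + tw μ k X' * sgn (xor a₁ b₁)) *
                Φ (k + 3 + W) (regAt s W (regAt X 3 r)) (P + wt X + wt s) := by
            rw [← sgn_mul_sgn, ← sgn_mul_sgn]; ring
          rw [this, norm_mul, norm_mul, norm_tw μ hμ, one_mul]
          exact mul_le_mul (hpair _ _) (hΦ _ _) (norm_nonneg _) hβ0
      _ = β * (2 ^ W * M) := by rw [sum_const, card_univ, Fintype.card_fun, Fintype.card_bool, Fintype.card_fin, nsmul_eq_mul]; push_cast; ring
  rw [hGG]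
  calc _ ≤ β * (2 ^ W * M) + 6 * (2 ^ W * M) := norm_add_le_of_le hpair' hrest
    _ = 2 ^ W * (6 + β) * M := by ring

/-- the GREEDY block count: scan `[k, k+L)`, open a block of length `W+3` at every good position, else skip one. -/
def nb (gd : ℕ → Bool) (W : ℕ) : ℕ → ℕ → ℕ
  | k, L =>
    if h : W + 3 ≤ L then
      (if gd k then nb gd W (k + 3 + W) (L - (W + 3)) + 1 else nb gd W (k + 1) (L - 1))
    else 0
  termination_by _ L => L
  decreasing_by all_goals omega

/-- CharDialFormJuntaA helper `nb_block` (decomp-qadv land package; see the module docstring). -/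
theorem nb_block {gd : ℕ → Bool} {W k L : ℕ} (h : W + 3 ≤ L) (hg : gd k = true) :
    nb gd W k L = nb gd W (k + 3 + W) (L - (W + 3)) + 1 := by
  rw [nb, dif_pos h, if_pos hg]

/-- CharDialFormJuntaA helper `nb_skip` (decomp-qadv land package; see the module docstring). -/
theorem nb_skip {gd : ℕ → Bool} {W k L : ℕ} (h : W + 3 ≤ L) (hg : ¬ gd k = true) :
    nb gd W k L = nb gd W (k + 1) (L - 1) := by
  rw [nb, dif_pos h, if_neg hg]

/-- CharDialFormJuntaA helper `nb_tail` (decomp-qadv land package; see the module docstring). -/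
theorem nb_tail {gd : ℕ → Bool} {W k L : ℕ} (h : ¬ W + 3 ≤ L) : nb gd W k L = 0 := by
  rw [nb, dif_neg h]


end PTransfer
end Summit.QuantumAdvantage.AdviceFreeQNC0.WindowCounter
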